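/-
COR-CM (cell pub-hodgecm2, stage 2 of the Hodge ladder) — count-neutral KERNEL CENSUS CHECKS (hinted / pre-expanded), degree 16, type ℤ/16
(seat prover-pub-hodgecm2-b23-g35-0, binder prover b23; claim DEG16-CYCLIC; sequel of `CorCM/FaceCensusHintedChecksPre.lean` and
`Census/HexadecicFaceGeneratorsCyclic{A,B,C}.lean`).  Theorems only: linear-time side checks of `FaceCensus.hgen_of_preChecks` decided in the
kernel (`decide +kernel`) against the census data (BY NAME); split across `…ChecksA/B/C.lean` so that each file verifies in < 4 min on the farm.
No definition, no named fact; `Interfaces.lean` (C1), every E term, B01 and `Transposition/*` untouched.  HONEST FRAMING: `HC_CM` is NOT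
proved; nothing here is a headline.  T5: n/a-class (closed Bool identities).
-/
import Summits.HodgeConjecture.CorCM.Census.HexadecicFaceGeneratorsCyclicC
import HarnessLib

/-!
# Degree 16, cyclic type `ℤ/16`: kernel side checks of the census transport — orbit cells, pair labels, transversal and hinted cover
-/

namespace Summit.HodgeConjecture.CorCM.HexadecicFaceTransport.Cyclic

open Summit.HodgeConjecture.CorCM.Census.FaceSquaresModel (mem flipAt normalize)
open Summit.HodgeConjecture.CorCM.Census.HexadecicFaceGeneratorsCyclic

set_option maxRecDepth 400000 in
set_option maxHeartbeats 4000000 in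
/-- Side check 1′ (ORBIT CELLS, flat form): every generator face of every certificate lies in `cellsFlat genReps`. [folklore] -/
theorem cellsFlatOK : (certs.all fun c => c.2.1.all fun gi => (Γ.cellsFlat genReps).contains gi.1) = true := by
  decide +kernel

set_option maxRecDepth 400000 in
set_option maxHeartbeats 4000000 in
/-- Side check 2 (PAIR LABELS), bundled with the representative list (type-specific statement). [folklore] -/
theorem pairsOK : genReps = [(255, 257, 8224), (255, 514, 16448), (255, 4112, 8224), (765, 1028, 4112), (765, 1028, 32896), (765, 4112, 16448), (1275, 514, 2056), (1275, 514, 4112), (1275, 2056, 4112), (1275, 4112, 8224), (1275, 8224, 16448), (2295, 4112, 32896), (2805, 16448, 32896), (4845, 2056, 8224), (4845, 2056, 32896)] ∧ (certs.all fun c => c.2.2.all fun pj => Γ.isCMType pj.1) = true :=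
  ⟨rfl, by decide +kernel⟩

set_option maxRecDepth 400000 in
set_option maxHeartbeats 4000000 in
/-- Side check 4a (COVER, types): every CM type twists into the transversal `trans`. [folklore] -/
theorem coverA : (Γ.cmTypes.all fun T => (List.finRange 16).any fun j => trans.contains (Γ.twist j T)) = true := by
  decide +kernel

set_option maxRecDepth 400000 in
set_option maxHeartbeats 4000000 in
/-- Side check 4b′ (COVER, hinted): every hint is correct. [folklore] -/
theorem coverHints : Γ.coverHintOK certs hints = true := by
  decide +kernel

set_option maxRecDepth 400000 in
set_option maxHeartbeats 4000000 in
/-- Side check 4c (hint list complete): the hinted faces are exactly `Γ.transFaces trans`. [folklore] -/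
theorem hintsComplete : Γ.hintFacesComplete trans hints = true := by
  decide +kernel

end Summit.HodgeConjecture.CorCM.HexadecicFaceTransport.Cyclic
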